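import Literature.NumberTheory.EllipticCurves.ZpExtensionGaloisTwistSelmerStructureProofs
import Literature.NumberTheory.EllipticCurves.ZpExtensionGaloisTwistWeilDual
import HarnessLib

/-!
# Route UniversalToricDescent — Greenberg's twisted descent, base step: the Poitou–Tate lifting for `E[p^J](χ_u)`
# with STRICT conditions on a finite set `Q` of target places (exact local values on `Q`), and the dual side's
# local vanishing at the places where the source structure is everything

Lead prover bsd-wall-utd-p1 g14 (`--supports` ♭T′ stmt-BirchSwinnertonDyer-26975; line `sigmacongruence` v3 — twist bricks for the
registered twin stubs `stub_twinStrictSurj` (TS1) / `stub_twinSigmaSurj` (TS2)). Greenberg, LNM 1716 pp. 122–124 (Prop. 4.13 and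
its Remark, run for the twist `A_s = E[p^∞] ⊗ κ^s` at level `K`): the map `γ' : H¹(K_Σ/K, M) → 𝒫^{Σ'}(M, K)` is onto when the
dual compact Selmer group vanishes. At FINITE level `M_J = E[p^J](χ_u)` (t42's `twistedTorsionGaloisModule`) and for the
structures of Castella's anticyclotomic setting this is Howard's Thm. 2.1.11 (tree predicate `LocalInvariants.SelmerComplement`,
a conjunct of the PROVED fact `poitouTate_selmerStructure_duality K`) for the pair
`𝓕_Q = (0 on Q, everything on S ∖ Q, unramified off S) ≤ 𝓖 = (everything on S, unramified off S)`,
`S = {∞} ∪ S₀ ∪ {v ∣ p}` (`twistedDescentPlaces`, `twistedRelaxedSelmerStructure`):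

* §1 `exists_twistedLift_strict_of_orthogonal` — if a target family `t` (arbitrary off `Q`) is orthogonal to every
  `y ∈ H¹_{𝓕_Q^*}(K, M_J^D)` (`∑_{v∈S} ⟨t_v, loc_v y⟩_v = 0`), some `x ∈ H¹(Γ_K, M_J)` unramified outside `S₀ ∪ {v ∣ p}` has
  `loc_q x = t_q` EXACTLY at every `q ∈ Q` (no `def`: `𝓕_Q` is the inline term `fun v ↦ if v ∈ Q then ⊥ else 𝓖 v`);
* §2 `localization_eq_zero_of_mem_dualSelmer_of_apply_eq_top` — generic in the structure: where `𝓕_v = ⊤`, dual classes are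
  locally trivial (perfectness); for `𝓕_Q` this is every `v ∈ S ∖ Q` — in the intended use `Q = {𝔭′} (∪ {v})`, so the dual
  class is STRICT at the conjugate prime `𝔭` and at `S₀ ∖ Q` (the shape of Castella's `Sel_𝔭^{S₀}` — the dual side of the
  strict-place lift is the CONJUGATE Selmer structure).

HONEST STATUS: helper theorems (Galois-cohomological plumbing of the rank-free road; the orthogonality itself — dual control +
exponent bookkeeping — and the tower-level descent are the sequel files). THEOREMS ONLY; no definition, no named fact, no `sorry`.
BSD is not advanced by this file.
References: [GreenbergLNM1716] §4 Prop. 4.13 + Remark, pp. 122–124; [Howard2004HeegnerKolyvagin] Thm. 2.1.11; [MilneADT2006] I Cor. 2.3,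
Thm. 4.10; [Castella2018] Def. 2.2.
-/

set_option autoImplicit false
-- `…BirchSwinnertonDyer.BirchSwinnertonDyer.Theorems…` is the problem's mandated namespace (D-0017).
set_option linter.dupNamespace false

noncomputable section
open scoped Classical

namespace Summit.BirchSwinnertonDyer.BirchSwinnertonDyer.Theorems.UniversalToricDescentTwistedDescent

open NumberField IsDedekindDomain Field WeierstrassCurve
open Literature.NumberTheory.EllipticCurves Literature.NumberTheory.GaloisRepresentations
  Literature.NumberTheory.GaloisCohomology
open Literature.NumberTheory.GaloisRepresentations.DiscreteGaloisModule (localTatePairingZMod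
  unramifiedSubgroup SelmerStructure)

universe u

variable {K : Type u} [Field K] [NumberField K] (W : WeierstrassCurve K) (p : ℕ) [Fact p.Prime]
  (S₀ : Finset (HeightOneSpectrum (𝓞 K))) (κ : ZpExtension K p) (J : ℕ) (u : ℤ) (hu : (p : ℤ) ∣ u - 1)

/-! ### §1 The Poitou–Tate lifting with strict conditions on `Q` -/

/-! `E[p^J]` finite is taken as an instance binder (true for an elliptic curve; no instance declared here). -/
variable [Finite (W.geomTorsion ((p ^ J : ℕ) : ℤ))]

/-- **Greenberg's `γ'` onto the `Q`-components, finite level (Prop. 4.13 + Remark, p. 123, through Howard Thm. 2.1.11).**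
Let `inv` have `SelmerComplement` at level `p^J`, `M_J = E[p^J](χ_u)` unramified with `p^J ∉ v` outside
`S = {∞} ∪ S₀ ∪ {v ∣ p}`, and `Q ⊆ S` a set of target places. If the target family `t` satisfies
`∑_{v∈S} ⟨t_v, loc_v y⟩_v = 0` for every `y` in the dual Selmer group of `𝓕_Q = (0 on Q, 𝓖 elsewhere)`, then some
`x ∈ H¹(Γ_K, M_J)`, unramified at every finite `v ∉ S₀` prime to `p`, has `loc_q x = t_q` at every `q ∈ Q`.
[cite: GreenbergLNM1716, §4 Prop. 4.13 and Remark (pp. 122–124)] [cite: Howard2004HeegnerKolyvagin, Thm. 2.1.11 (arXiv:1202.6340 p. 6)] -/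
theorem exists_twistedLift_strict_of_orthogonal {inv : LocalInvariants K (p ^ J)} (hSC : inv.SelmerComplement)
    (hS : ∀ v : HeightOneSpectrum (𝓞 K), (Sum.inr v : Place K) ∉ twistedDescentPlaces (K := K) p S₀ →
      ((p ^ J : ℕ) : 𝓞 K) ∉ v.asIdeal ∧ GaloisRep.IsUnramifiedAt v (W.twistedTorsionGaloisModule p κ J u hu))
    (Q : Finset (Place K)) (hQ : Q ⊆ twistedDescentPlaces (K := K) p S₀)
    (t : Π v : Place K, galoisCohomology ((W.twistedTorsionGaloisModule p κ J u hu).toLocal v) 1)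
    (horth : ∀ y ∈ (inv.dualSelmerStructure (W.twistedTorsionGaloisModule p κ J u hu)
        (fun v ↦ if v ∈ Q then ⊥ else W.twistedRelaxedSelmerStructure p S₀ κ J u hu v)).selmerGroup,
      ∑ v ∈ twistedDescentPlaces (K := K) p S₀,
        localTatePairingZMod (W.twistedTorsionGaloisModule p κ J u hu) (p ^ J) v (inv v) (t v)
          (galoisCohomology.localization ((W.twistedTorsionGaloisModule p κ J u hu).tateDual (p ^ J))
            v 1 y) = 0) :
    ∃ x : galoisCohomology (W.twistedTorsionGaloisModule p κ J u hu) 1,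
      (∀ v : HeightOneSpectrum (𝓞 K), v ∉ S₀ → ((p : ℕ) : 𝓞 K) ∉ v.asIdeal →
        galoisCohomology.res (W.twistedTorsionGaloisModule p κ J u hu) (v.adicCompletion K) 1 x ∈
          unramifiedSubgroup ((W.twistedTorsionGaloisModule p κ J u hu).restrictField (v.adicCompletion K)) 1) ∧
      ∀ q ∈ Q, galoisCohomology.localization (W.twistedTorsionGaloisModule p κ J u hu) q 1 x = t q := by
  have hM : ∀ m : geomTorsion W ((p ^ J : ℕ) : ℤ), (p ^ J) • m = 0 := W.pow_nsmul_geomTorsion_pow p J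
  -- the strict structure `𝓕_Q ≤ 𝓖`, both unramified outside `S`
  have hle : (fun v ↦ if v ∈ Q then ⊥ else W.twistedRelaxedSelmerStructure p S₀ κ J u hu v) ≤
      W.twistedRelaxedSelmerStructure p S₀ κ J u hu := by
    intro v
    by_cases hv : v ∈ Q
    · simp only [hv, if_true]; exact bot_le
    · simp only [hv, if_false]; exact le_rfl
  have hunr : SelmerStructure.IsUnramifiedOutside
      (fun v ↦ if v ∈ Q then ⊥ else W.twistedRelaxedSelmerStructure p S₀ κ J u hu v)
      (twistedDescentPlaces (K := K) p S₀) := by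
    refine ⟨inl_mem_twistedDescentPlaces p S₀, fun v hv ↦ ?_⟩
    have hvQ : (Sum.inr v : Place K) ∉ Q := fun h ↦ hv (hQ h)
    simp only [hvQ, if_false]
    exact (W.isUnramifiedOutside_twistedRelaxedSelmerStructure p S₀ κ J u hu).2 v hv
  obtain ⟨x, hx, hxt⟩ := (hSC (W.twistedTorsionGaloisModule p κ J u hu) hM (twistedDescentPlaces (K := K) p S₀) hS
    (fun v ↦ if v ∈ Q then ⊥ else W.twistedRelaxedSelmerStructure p S₀ κ J u hu v)
    (W.twistedRelaxedSelmerStructure p S₀ κ J u hu) hle hunr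
    (W.isUnramifiedOutside_twistedRelaxedSelmerStructure p S₀ κ J u hu)).1 t
    (fun v hv ↦ by
      rw [W.twistedRelaxedSelmerStructure_eq_top_of_mem p S₀ κ J u hu hv]
      exact AddSubgroup.mem_top _)
    horth
  refine ⟨x, fun v hv hpv ↦ W.res_mem_unramifiedSubgroup_of_mem_selmerGroup_relaxed p S₀ κ J u hu hx hv hpv,
    fun q hq ↦ ?_⟩
  have h := hxt q (hQ hq)
  simp only [hq, if_true, AddSubgroup.mem_bot] at h
  exact sub_eq_zero.mp h

/-! ### §2 The dual side at the places where the structure is everything -/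

omit [NumberField K] in
/-- **Where `𝓕_v = ⊤` a dual Selmer class is locally trivial** (`⊤^* = 0` by the perfectness of the local Tate pairing;
generic in the structure `𝓕` — Greenberg p. 123 «`U'^*_{v₀} = 0`»). For `𝓕_Q` this holds at every `v ∈ S ∖ Q`: in Castella's
setting at the conjugate prime `𝔭` and at `S₀ ∖ Q`. [cite: GreenbergLNM1716, §4 p. 123] [cite: MilneADT2006, Ch. I, Cor. 2.3] -/
theorem localization_eq_zero_of_mem_dualSelmer_of_apply_eq_top [NumberField K] {inv : LocalInvariants K (p ^ J)}
    (hperf : inv.IsPerfect) (𝓕 : SelmerStructure (W.twistedTorsionGaloisModule p κ J u hu))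
    {y : galoisCohomology ((W.twistedTorsionGaloisModule p κ J u hu).tateDual (p ^ J)) 1}
    (hy : y ∈ (inv.dualSelmerStructure (W.twistedTorsionGaloisModule p κ J u hu) 𝓕).selmerGroup)
    {v : HeightOneSpectrum (𝓞 K)} (hv : 𝓕 (Sum.inr v) = ⊤) :
    galoisCohomology.localization ((W.twistedTorsionGaloisModule p κ J u hu).tateDual (p ^ J)) (Sum.inr v) 1 y = 0 := by
  rw [SelmerStructure.mem_selmerGroup_iff] at hy
  have hyv := hy (Sum.inr v)
  rw [LocalInvariants.dualSelmerStructure_apply, hv, LocalInvariants.mem_dualLocalCondition_iff] at hyv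
  have hinj := ((hperf v).2 (W.twistedTorsionGaloisModule p κ J u hu) (W.pow_nsmul_geomTorsion_pow p J)).2.1
  apply hinj
  rw [map_zero]
  exact AddMonoidHom.ext fun b ↦ by
    rw [AddMonoidHom.flip_apply, AddMonoidHom.zero_apply]
    exact hyv b (AddSubgroup.mem_top b)

/-- **For `𝓕_Q` and a finite place `v` of `S` NOT in `Q`, dual classes are locally trivial at `v`.**
[cite: GreenbergLNM1716, §4 p. 123] -/
theorem localization_eq_zero_of_mem_dualSelmer_strict {inv : LocalInvariants K (p ^ J)} (hperf : inv.IsPerfect)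
    (Q : Finset (Place K))
    {y : galoisCohomology ((W.twistedTorsionGaloisModule p κ J u hu).tateDual (p ^ J)) 1}
    (hy : y ∈ (inv.dualSelmerStructure (W.twistedTorsionGaloisModule p κ J u hu)
        (fun v ↦ if v ∈ Q then ⊥ else W.twistedRelaxedSelmerStructure p S₀ κ J u hu v)).selmerGroup)
    {v : HeightOneSpectrum (𝓞 K)} (hvS : (Sum.inr v : Place K) ∈ twistedDescentPlaces (K := K) p S₀)
    (hvQ : (Sum.inr v : Place K) ∉ Q) :
    galoisCohomology.localization ((W.twistedTorsionGaloisModule p κ J u hu).tateDual (p ^ J)) (Sum.inr v) 1 y = 0 := by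
  refine localization_eq_zero_of_mem_dualSelmer_of_apply_eq_top W p κ J u hu hperf _ hy ?_
  simp only [hvQ, if_false]
  exact W.twistedRelaxedSelmerStructure_eq_top_of_mem p S₀ κ J u hu hvS

/-- **For `𝓕_Q` and a finite place `v ∉ S₀`, `v ∤ p`, dual classes satisfy the dual of the unramified condition**
(unfolding; with Milne I 2.6 `UnramifiedOrthogonal` this is `H¹_ur(M_J^D)`). [cite: MilneADT2006, Ch. I, Thm. 2.6] -/
theorem localization_mem_dual_unramified_of_mem_dualSelmer_strict {inv : LocalInvariants K (p ^ J)}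
    (hUO : inv.UnramifiedOrthogonal) (Q : Finset (Place K)) (hQ : Q ⊆ twistedDescentPlaces (K := K) p S₀)
    {y : galoisCohomology ((W.twistedTorsionGaloisModule p κ J u hu).tateDual (p ^ J)) 1}
    (hy : y ∈ (inv.dualSelmerStructure (W.twistedTorsionGaloisModule p κ J u hu)
        (fun v ↦ if v ∈ Q then ⊥ else W.twistedRelaxedSelmerStructure p S₀ κ J u hu v)).selmerGroup)
    {v : HeightOneSpectrum (𝓞 K)} (hv : v ∉ S₀) (hpv : ((p : ℕ) : 𝓞 K) ∉ v.asIdeal)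
    (hpJ : ((p ^ J : ℕ) : 𝓞 K) ∉ v.asIdeal)
    (hur : GaloisRep.IsUnramifiedAt v (W.twistedTorsionGaloisModule p κ J u hu)) :
    galoisCohomology.localization ((W.twistedTorsionGaloisModule p κ J u hu).tateDual (p ^ J)) (Sum.inr v) 1 y ∈
      unramifiedSubgroup (GaloisRep.toLocal v ((W.twistedTorsionGaloisModule p κ J u hu).tateDual (p ^ J))) 1 := by
  rw [SelmerStructure.mem_selmerGroup_iff] at hy
  have hyv := hy (Sum.inr v)
  have hvQ : (Sum.inr v : Place K) ∉ Q := fun h ↦ by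
    have := (not_mem_twistedDescentPlaces_iff p S₀ v).2 ⟨hv, hpv⟩
    exact this (hQ h)
  rw [LocalInvariants.dualSelmerStructure_apply] at hyv
  simp only [hvQ, if_false] at hyv
  rw [W.twistedRelaxedSelmerStructure_inr_of_not_mem p S₀ κ J u hu hv hpv,
    (hUO (W.twistedTorsionGaloisModule p κ J u hu) (W.pow_nsmul_geomTorsion_pow p J) v hpJ hur).1] at hyv
  exact hyv

end Summit.BirchSwinnertonDyer.BirchSwinnertonDyer.Theorems.UniversalToricDescentTwistedDescent

end
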